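import Summits.QuantumFields.YangMills.Theorems.LangevinControlUVFemtoCurvatureTwoPointCDoublingConePointwise
import HarnessLib

/-!
# Crux `FemtoCurvatureTwoPointC` (stmt-QuantumFields-16204), line `Sketch`, v7 — the CONE estimate

Lead's package behind `stub_sublevelDoubling`, file P3c (`--supports stmt-QuantumFields-16204`). At a flat `τ`:

* `wilsonAction_eq_quarter_sum` — `S(U) = ¼ Σ_{x,i,j} ‖ρ U_{x;ij} − 1‖²` (all ordered pairs; the holonomy of `(j,i)` is the inverse
  of that of `(i,j)` — cf. the tree's `asm_plaquetteHolonomy_symm` — and the diagonal is trivial);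
* `cone_two_sided` — for `C ∈ constForms τ`, `B ∈ massive τ` of norm `≤ δ`:
  `k (Q(C) + ‖B‖²) ≤ S(cfg τ (C + B)) ≤ K (Q(C) + ‖B‖²)` (`Q = commForm`), from the per-plaquette decomposition
  (`…ConePointwise`), the vanishing cross term, the Koszul lower bound on the massive directions and the commutator/bracket comparison;
* `exists_cone` (registered sub-goal) — for `A ∈ slice τ`, `‖A‖ ≤ δ`, `s ∈ [0,1]`: `S(cfg τ (s • A)) ≤ K s² S(cfg τ A)`
  (split `A = C + B` by the orthogonal projection onto `constForms ≤ slice`; `Q(sC) = s⁴ Q(C)`).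
Everything here is proved; no definitions.
-/

set_option autoImplicit false

noncomputable section

open scoped Matrix Matrix.Norms.Frobenius InnerProductSpace
open NormedSpace
open Literature.MathematicalPhysics.QuantumLattice Literature.MathematicalPhysics.QuantumFieldTheory
open Summit.QuantumFields.YangMills.Theorems.FreeEnergyLogCoefficient

namespace Summit.QuantumFields.YangMills.Theorems.FemtoCurvatureTwoPointC.Doubling

variable {G : Type} [Group G] [TopologicalSpace G] [CompactSpace G] (r : LatticeRep G) {L : ℕ}

/-! ### The action as a quarter sum over ordered pairs -/

/-- A symmetric function on `Fin 4 × Fin 4` with zero diagonal sums over `i < j` to half its full sum. -/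
theorem sum_lt_pairs_eq_half (h : Fin 4 → Fin 4 → ℝ) (h0 : ∀ i, h i i = 0) (hs : ∀ i j, h i j = h j i) :
    ∑ q : {q : Fin 4 × Fin 4 // q.1 < q.2}, h q.1.1 q.1.2 = (∑ i, ∑ j, h i j) / 2 := by
  have e : ∑ q : {q : Fin 4 × Fin 4 // q.1 < q.2}, h q.1.1 q.1.2 =
      ∑ q ∈ Finset.univ.filter (fun q : Fin 4 × Fin 4 => q.1 < q.2), h q.1 q.2 :=
    (Finset.sum_subtype _ (by simp) (fun q : Fin 4 × Fin 4 => h q.1 q.2)).symm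
  rw [e, Finset.sum_filter, ← Finset.univ_product_univ, Finset.sum_product]
  simp only [Fin.sum_univ_four, Fin.isValue, h0, hs 1 0, hs 2 0, hs 3 0, hs 2 1, hs 3 1, hs 3 2]
  have l01 : (0 : Fin 4) < 1 := by decide
  have l02 : (0 : Fin 4) < 2 := by decide
  have l03 : (0 : Fin 4) < 3 := by decide
  have l12 : (1 : Fin 4) < 2 := by decide
  have l13 : (1 : Fin 4) < 3 := by decide
  have l23 : (2 : Fin 4) < 3 := by decide
  have n10 : ¬ (1 : Fin 4) < 0 := by decide
  have n20 : ¬ (2 : Fin 4) < 0 := by decide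
  have n30 : ¬ (3 : Fin 4) < 0 := by decide
  have n21 : ¬ (2 : Fin 4) < 1 := by decide
  have n31 : ¬ (3 : Fin 4) < 1 := by decide
  have n32 : ¬ (3 : Fin 4) < 2 := by decide
  simp only [lt_self_iff_false, if_false, l01, l02, l03, l12, l13, l23, n10, n20, n30, n21, n31, n32, if_true]
  ring

omit [TopologicalSpace G] [CompactSpace G] in
/-- The diagonal "plaquette" is trivial. -/
theorem plaquetteHolonomy_self (U : GaugeConfig 4 L G) (x : Site 4 L) (i : Fin 4) : plaquetteHolonomy U x i i = 1 := by
  simp [plaquetteHolonomy]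

omit [CompactSpace G] in
/-- `‖ρ g⁻¹ − 1‖ = ‖ρ g − 1‖` for a unitary representation. -/
theorem norm_rho_inv_sub_one (g : G) : ‖r.ρ g⁻¹ - 1‖ = ‖r.ρ g - 1‖ := by
  rw [← conjTranspose_rho, show (r.ρ g)ᴴ - 1 = (r.ρ g - 1)ᴴ by rw [Matrix.conjTranspose_sub, Matrix.conjTranspose_one],
    Matrix.frobenius_norm_conjTranspose]

omit [CompactSpace G] in
/-- **The Wilson action as a quarter sum over all ordered direction pairs**: `S(U) = ¼ Σ_{x,i,j} ‖ρ U_{x;ij} − 1‖²`. -/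
theorem wilsonAction_eq_quarter_sum [NeZero L] (U : GaugeConfig 4 L G) :
    wilsonAction r.ρ U = (∑ x : Site 4 L, ∑ i : Fin 4, ∑ j : Fin 4, ‖r.ρ (plaquetteHolonomy U x i j) - 1‖ ^ 2) / 4 := by
  rw [wilsonAction_eq_sum_norm_sq, Fintype.sum_prod_type, Finset.sum_div]
  refine Finset.sum_congr rfl fun x _ => ?_
  have hswap : ∀ i j : Fin 4, plaquetteHolonomy U x j i = (plaquetteHolonomy U x i j)⁻¹ := fun i j => by
    simp only [plaquetteHolonomy, mul_inv_rev, inv_inv, mul_assoc]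
  have h := sum_lt_pairs_eq_half (fun i j => ‖r.ρ (plaquetteHolonomy U x i j) - 1‖ ^ 2)
    (fun i => by simp [plaquetteHolonomy_self]) (fun i j => by rw [hswap i j, norm_rho_inv_sub_one])
  have h2 : ∑ q : {q : Fin 4 × Fin 4 // q.1 < q.2}, ‖1 - r.ρ (plaquetteHolonomy U x q.1.1 q.1.2)‖ ^ 2 / 2 =
      (∑ q : {q : Fin 4 × Fin 4 // q.1 < q.2}, ‖r.ρ (plaquetteHolonomy U x q.1.1 q.1.2) - 1‖ ^ 2) / 2 := by
    rw [Finset.sum_div]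
    exact Finset.sum_congr rfl fun q _ => by rw [norm_sub_rev]
  rw [h2, h]
  ring

/-! ### Bookkeeping of component sums -/

omit [CompactSpace G] in
/-- The squared `L²` norm of a 1-form as a double sum over sites and directions. -/
theorem norm_sq_eq_sum_sum [NeZero L] (B : OneForm r L) :
    ‖B‖ ^ 2 = ∑ x : Site 4 L, ∑ j : Fin 4, ‖B (x, j)‖ ^ 2 := by
  rw [PiLp.norm_sq_eq_of_L2, Fintype.sum_prod_type]

omit [CompactSpace G] in
/-- A single direction's site sum is bounded by the squared norm. -/
theorem sum_comp_sq_le [NeZero L] (B : OneForm r L) (j : Fin 4) : ∑ x : Site 4 L, ‖B (x, j)‖ ^ 2 ≤ ‖B‖ ^ 2 := by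
  rw [norm_sq_eq_sum_sum]
  exact Finset.sum_le_sum fun x _ =>
    Finset.single_le_sum (f := fun j' => ‖B (x, j')‖ ^ 2) (fun _ _ => sq_nonneg _) (Finset.mem_univ j)

omit [CompactSpace G] in
/-- Re-indexing a shifted site sum. -/
theorem sum_shift_comp_sq [NeZero L] (B : OneForm r L) (i j : Fin 4) :
    ∑ x : Site 4 L, ‖B (x.shift i, j)‖ ^ 2 = ∑ x : Site 4 L, ‖B (x, j)‖ ^ 2 :=
  Function.Bijective.sum_comp (shift_bijective (L := L) i) (fun y => ‖B (y, j)‖ ^ 2)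

omit [CompactSpace G] in
/-- The norm of a component function is bounded by the norm of the form. -/
theorem norm_comp_le [NeZero L] (B : OneForm r L) (j : Fin 4) : ‖comp r B j‖ ≤ ‖B‖ := by
  have h : ‖comp r B j‖ ^ 2 ≤ ‖B‖ ^ 2 := by
    rw [PiLp.norm_sq_eq_of_L2]
    simpa using sum_comp_sq_le r B j
  exact (pow_le_pow_iff_left₀ (norm_nonneg _) (norm_nonneg _) two_ne_zero).1 h

/-- **The linearised curvature is bounded**: `‖dOne τ B i j‖ ≤ 4 ‖B‖`. -/
theorem norm_dOne_le [NeZero L] (τ : GaugeConfig 4 L G) (B : OneForm r L) (i j : Fin 4) : ‖dOne r τ B i j‖ ≤ 4 * ‖B‖ := by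
  unfold dOne
  have h1 := norm_transport r τ i (comp r B j)
  have h2 := norm_transport r τ j (comp r B i)
  have h3 := norm_comp_le r B i
  have h4 := norm_comp_le r B j
  calc _ ≤ ‖transport r τ i (comp r B j) - comp r B j‖ + ‖transport r τ j (comp r B i) - comp r B i‖ := norm_sub_le _ _
    _ ≤ (‖transport r τ i (comp r B j)‖ + ‖comp r B j‖) + (‖transport r τ j (comp r B i)‖ + ‖comp r B i‖) :=
        add_le_add (norm_sub_le _ _) (norm_sub_le _ _)
    _ ≤ 4 * ‖B‖ := by rw [h1, h2]; linarith

omit [CompactSpace G] in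
/-- Reordering a triple sum over sites and two directions. -/
theorem sum3_comm [NeZero L] (f : Site 4 L → Fin 4 → Fin 4 → ℝ) :
    ∑ x : Site 4 L, ∑ i : Fin 4, ∑ j : Fin 4, f x i j = ∑ i : Fin 4, ∑ j : Fin 4, ∑ x : Site 4 L, f x i j := by
  rw [Finset.sum_comm]
  exact Finset.sum_congr rfl fun i _ => Finset.sum_comm

/-! ### The two-sided cone estimate -/

/-- **CONE, two-sided.** At a flat `τ` there are `δ, k, K > 0` such that for `C ∈ constForms τ`, `B ∈ massive τ` with
`‖C‖, ‖B‖ ≤ δ`: `k (Q(C) + ‖B‖²) ≤ S(cfg τ (C + B)) ≤ K (Q(C) + ‖B‖²)`. -/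
theorem cone_two_sided [NeZero L] {τ : GaugeConfig 4 L G}
    (hτ : ∀ (x : Site 4 L) (i j : Fin 4), plaquetteHolonomy τ x i j = 1) :
    ∃ δ k K : ℝ, 0 < δ ∧ 0 < k ∧ 0 < K ∧ ∀ C ∈ constForms r τ, ∀ B ∈ massive r τ, ‖C‖ ≤ δ → ‖B‖ ≤ δ →
      k * (commForm r C + ‖B‖ ^ 2) ≤ wilsonAction r.ρ (cfg r τ (C + B)) ∧
        wilsonAction r.ρ (cfg r τ (C + B)) ≤ K * (commForm r C + ‖B‖ ^ 2) := by
  obtain ⟨lam, hlam, hkos⟩ := exists_dOne_lower_bound r hτ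
  refine ⟨min (1 / 4) (lam / 768), min (1 / 128) (lam ^ 2 / 16), 7104, by positivity, by positivity, by norm_num, ?_⟩
  intro C hC B hB hCδ hBδ
  have hδ4 : min (1 / 4 : ℝ) (lam / 768) ≤ 1 / 4 := min_le_left _ _
  have hδl : min (1 / 4 : ℝ) (lam / 768) ≤ lam / 768 := min_le_right _ _
  set δ := min (1 / 4 : ℝ) (lam / 768) with hδdef
  have hδ0 : 0 ≤ δ := by positivity
  -- component bounds
  have cC : ∀ e : Edge 4 L, ‖C e‖ ≤ 1 / 4 := fun e => ((PiLp.norm_apply_le C e).trans hCδ).trans hδ4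
  have cB : ∀ e : Edge 4 L, ‖B e‖ ≤ 1 / 4 := fun e => ((PiLp.norm_apply_le B e).trans hBδ).trans hδ4
  have cBδ : ∀ e : Edge 4 L, ‖B e‖ ≤ δ := fun e => (PiLp.norm_apply_le B e).trans hBδ
  have cCδ : ∀ e : Edge 4 L, ‖C e‖ ≤ δ := fun e => (PiLp.norm_apply_le C e).trans hCδ
  -- notation for the per-plaquette pieces
  set u : Site 4 L → Fin 4 → Fin 4 → Matrix (Fin r.N) (Fin r.N) ℂ :=
    fun x i j => r.ρ (plaquetteHolonomy (cfg r τ (C + B)) x i j) with hu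
  set α : Site 4 L → Fin 4 → Fin 4 → Matrix (Fin r.N) (Fin r.N) ℂ := fun x i j =>
    exp (lieIso r.ρ (C (x, i))) * exp (lieIso r.ρ (C (x, j))) * exp (-lieIso r.ρ (C (x, i))) *
      exp (-lieIso r.ρ (C (x, j))) - 1 with hα
  set β : Site 4 L → Fin 4 → Fin 4 → Matrix (Fin r.N) (Fin r.N) ℂ := fun x i j => lieIso r.ρ (dOne r τ B i j x) with hβ
  set bs : Site 4 L → Fin 4 → Fin 4 → ℝ := fun x i j =>
    ‖B (x, i)‖ + ‖B (x.shift i, j)‖ + ‖B (x.shift j, i)‖ + ‖B (x, j)‖ with hbs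
  set bq : Site 4 L → Fin 4 → Fin 4 → ℝ := fun x i j =>
    ‖B (x, i)‖ ^ 2 + ‖B (x.shift i, j)‖ ^ 2 + ‖B (x.shift j, i)‖ ^ 2 + ‖B (x, j)‖ ^ 2 with hbq
  -- the per-plaquette remainder bound: `‖ℰ‖ ≤ 24 δ · bs`
  have hE : ∀ x i j, ‖(u x i j - 1) - α x i j - β x i j‖ ≤ 24 * δ * bs x i j := by
    intro x i j
    have h := norm_hol_sub_one_sub_sub_le r (hτ x i j) hC B (cC _) (cC _) (cB _) (cB _) (cB _) (cB _)
    refine h.trans ?_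
    have hσ : 2 * ‖C (x, i)‖ + 2 * ‖C (x, j)‖ + (‖B (x, i)‖ + ‖B (x.shift i, j)‖ + ‖B (x.shift j, i)‖ + ‖B (x, j)‖) ≤
        8 * δ := by linarith [cCδ (x, i), cCδ (x, j), cBδ (x, i), cBδ (x.shift i, j), cBδ (x.shift j, i), cBδ (x, j)]
    have hbs0 : 0 ≤ bs x i j := by positivity
    calc _ ≤ 3 * (8 * δ) * bs x i j := by
          rw [hbs]; exact mul_le_mul_of_nonneg_right (mul_le_mul_of_nonneg_left hσ (by norm_num)) hbs0
      _ = 24 * δ * bs x i j := by ring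
  have hE2 : ∀ x i j, ‖(u x i j - 1) - α x i j - β x i j‖ ^ 2 ≤ 2304 * δ ^ 2 * bq x i j := by
    intro x i j
    have h := pow_le_pow_left₀ (norm_nonneg _) (hE x i j) 2
    have hsq : bs x i j ^ 2 ≤ 4 * bq x i j := by
      rw [hbs, hbq]
      nlinarith [sq_nonneg (‖B (x, i)‖ - ‖B (x.shift i, j)‖), sq_nonneg (‖B (x, i)‖ - ‖B (x.shift j, i)‖),
        sq_nonneg (‖B (x, i)‖ - ‖B (x, j)‖), sq_nonneg (‖B (x.shift i, j)‖ - ‖B (x.shift j, i)‖),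
        sq_nonneg (‖B (x.shift i, j)‖ - ‖B (x, j)‖), sq_nonneg (‖B (x.shift j, i)‖ - ‖B (x, j)‖)]
    calc _ ≤ (24 * δ * bs x i j) ^ 2 := h
      _ = 576 * δ ^ 2 * bs x i j ^ 2 := by ring
      _ ≤ 576 * δ ^ 2 * (4 * bq x i j) := by gcongr
      _ = _ := by ring
  -- the sum of the `bq`
  have hbq_sum : ∑ x : Site 4 L, ∑ i : Fin 4, ∑ j : Fin 4, bq x i j ≤ 64 * ‖B‖ ^ 2 := by
    have hx : ∀ i j, ∑ x : Site 4 L, bq x i j =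
        2 * ∑ x : Site 4 L, ‖B (x, i)‖ ^ 2 + 2 * ∑ x : Site 4 L, ‖B (x, j)‖ ^ 2 := by
      intro i j
      simp only [hbq]
      rw [Finset.sum_add_distrib, Finset.sum_add_distrib, Finset.sum_add_distrib, sum_shift_comp_sq r B i j,
        sum_shift_comp_sq r B j i]
      ring
    rw [sum3_comm]
    simp only [hx]
    have hn := sum_comp_sq_le r B
    calc ∑ i : Fin 4, ∑ j : Fin 4, (2 * ∑ x : Site 4 L, ‖B (x, i)‖ ^ 2 + 2 * ∑ x : Site 4 L, ‖B (x, j)‖ ^ 2)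
          ≤ ∑ _i : Fin 4, ∑ _j : Fin 4, (2 * ‖B‖ ^ 2 + 2 * ‖B‖ ^ 2) := by
          refine Finset.sum_le_sum fun i _ => Finset.sum_le_sum fun j _ => ?_
          linarith [hn i, hn j]
      _ = 64 * ‖B‖ ^ 2 := by simp; ring
  have hE_sum : ∑ x : Site 4 L, ∑ i : Fin 4, ∑ j : Fin 4, ‖(u x i j - 1) - α x i j - β x i j‖ ^ 2 ≤
      147456 * δ ^ 2 * ‖B‖ ^ 2 := by
    calc _ ≤ ∑ x : Site 4 L, ∑ i : Fin 4, ∑ j : Fin 4, 2304 * δ ^ 2 * bq x i j :=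
          Finset.sum_le_sum fun x _ => Finset.sum_le_sum fun i _ => Finset.sum_le_sum fun j _ => hE2 x i j
      _ = 2304 * δ ^ 2 * ∑ x : Site 4 L, ∑ i : Fin 4, ∑ j : Fin 4, bq x i j := by simp only [Finset.mul_sum]
      _ ≤ 2304 * δ ^ 2 * (64 * ‖B‖ ^ 2) := by gcongr
      _ = _ := by ring
  -- the `β` sums
  have hβ_sum : ∀ i j, ∑ x : Site 4 L, ‖β x i j‖ ^ 2 = ‖dOne r τ B i j‖ ^ 2 := by
    intro i j
    rw [PiLp.norm_sq_eq_of_L2]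
    simp only [hβ, norm_lieIso]
  have hβ_lower : lam ^ 2 * ‖B‖ ^ 2 ≤ ∑ x : Site 4 L, ∑ i : Fin 4, ∑ j : Fin 4, ‖β x i j‖ ^ 2 := by
    rw [sum3_comm]
    simp only [hβ_sum]
    exact hkos B hB
  have hβ_upper : ∑ x : Site 4 L, ∑ i : Fin 4, ∑ j : Fin 4, ‖β x i j‖ ^ 2 ≤ 256 * ‖B‖ ^ 2 := by
    rw [sum3_comm]
    simp only [hβ_sum]
    calc ∑ i : Fin 4, ∑ j : Fin 4, ‖dOne r τ B i j‖ ^ 2 ≤ ∑ _i : Fin 4, ∑ _j : Fin 4, (4 * ‖B‖) ^ 2 :=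
          Finset.sum_le_sum fun i _ => Finset.sum_le_sum fun j _ =>
            pow_le_pow_left₀ (norm_nonneg _) (norm_dOne_le r τ B i j) 2
      _ = 256 * ‖B‖ ^ 2 := by simp; ring
  -- the `α` sums
  have sk : ∀ a : Fib r, (lieIso r.ρ a)ᴴ = -lieIso r.ρ a := conjTranspose_lieIso r.ρ
  have hα_lower : commForm r C / 16 ≤ ∑ x : Site 4 L, ∑ i : Fin 4, ∑ j : Fin 4, ‖α x i j‖ ^ 2 := by
    rw [commForm, Finset.sum_div]
    refine Finset.sum_le_sum fun x _ => ?_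
    rw [Finset.sum_div]
    refine Finset.sum_le_sum fun i _ => ?_
    rw [Finset.sum_div]
    refine Finset.sum_le_sum fun j _ => ?_
    exact bracket_sq_le_comm_sq r (sk _) (sk _) (by rw [norm_lieIso]; exact cC _) (by rw [norm_lieIso]; exact cC _)
  have hα_upper : ∑ x : Site 4 L, ∑ i : Fin 4, ∑ j : Fin 4, ‖α x i j‖ ^ 2 ≤ commForm r C := by
    rw [commForm]
    exact Finset.sum_le_sum fun x _ => Finset.sum_le_sum fun i _ => Finset.sum_le_sum fun j _ =>
      comm_sq_le_bracket_sq r (sk _) (sk _)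
  -- the cross term
  have hcross : ∀ i j, ∑ x : Site 4 L, ‖α x i j + β x i j‖ ^ 2 =
      ∑ x : Site 4 L, ‖α x i j‖ ^ 2 + ∑ x : Site 4 L, ‖β x i j‖ ^ 2 := by
    intro i j
    have h0 := sum_re_trace_comm_dOne r hC B i j
    simp only [ConeAlgebra.norm_add_sq_eq, Finset.sum_add_distrib, ← Finset.mul_sum]
    simp only [hα, hβ] at h0 ⊢
    rw [h0, mul_zero, add_zero]
  -- the action as a quarter sum
  have hS : wilsonAction r.ρ (cfg r τ (C + B)) =
      (∑ x : Site 4 L, ∑ i : Fin 4, ∑ j : Fin 4, ‖u x i j - 1‖ ^ 2) / 4 := wilsonAction_eq_quarter_sum r _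
  have hcF0 : 0 ≤ commForm r C := commForm_nonneg r C
  constructor
  · -- LOWER
    have hpt : ∀ x i j, ‖α x i j + β x i j‖ ^ 2 / 2 - ‖(u x i j - 1) - α x i j - β x i j‖ ^ 2 ≤ ‖u x i j - 1‖ ^ 2 :=
      fun x i j => half_norm_add_sq_sub_le_norm_sub_one_sq r _ _ _
    have hsum : (∑ x : Site 4 L, ∑ i : Fin 4, ∑ j : Fin 4, ‖α x i j + β x i j‖ ^ 2) / 2 -
        ∑ x : Site 4 L, ∑ i : Fin 4, ∑ j : Fin 4, ‖(u x i j - 1) - α x i j - β x i j‖ ^ 2 ≤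
        ∑ x : Site 4 L, ∑ i : Fin 4, ∑ j : Fin 4, ‖u x i j - 1‖ ^ 2 := by
      rw [Finset.sum_div, ← Finset.sum_sub_distrib]
      refine Finset.sum_le_sum fun x _ => ?_
      rw [Finset.sum_div, ← Finset.sum_sub_distrib]
      refine Finset.sum_le_sum fun i _ => ?_
      rw [Finset.sum_div, ← Finset.sum_sub_distrib]
      exact Finset.sum_le_sum fun j _ => hpt x i j
    have hαβ : ∑ x : Site 4 L, ∑ i : Fin 4, ∑ j : Fin 4, ‖α x i j + β x i j‖ ^ 2 =
        ∑ x : Site 4 L, ∑ i : Fin 4, ∑ j : Fin 4, ‖α x i j‖ ^ 2 + ∑ x : Site 4 L, ∑ i : Fin 4, ∑ j : Fin 4, ‖β x i j‖ ^ 2 := by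
      rw [sum3_comm (fun x i j => ‖α x i j + β x i j‖ ^ 2), sum3_comm (fun x i j => ‖α x i j‖ ^ 2),
        sum3_comm (fun x i j => ‖β x i j‖ ^ 2), ← Finset.sum_add_distrib]
      refine Finset.sum_congr rfl fun i _ => ?_
      rw [← Finset.sum_add_distrib]
      exact Finset.sum_congr rfl fun j _ => hcross i j
    have hδsq : δ ^ 2 ≤ lam ^ 2 / 589824 := by
      have h := pow_le_pow_left₀ hδ0 hδl 2
      calc δ ^ 2 ≤ (lam / 768) ^ 2 := h
        _ = lam ^ 2 / 589824 := by ring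
    have hmink : min (1 / 128 : ℝ) (lam ^ 2 / 16) ≤ 1 / 128 := min_le_left _ _
    have hminl : min (1 / 128 : ℝ) (lam ^ 2 / 16) ≤ lam ^ 2 / 16 := min_le_right _ _
    rw [hS]
    have hB0 : 0 ≤ ‖B‖ ^ 2 := sq_nonneg _
    nlinarith [hsum, hαβ, hα_lower, hβ_lower, hE_sum, hδsq, mul_le_mul_of_nonneg_right hmink hcF0,
      mul_le_mul_of_nonneg_right hminl hB0, mul_nonneg (sq_nonneg lam) hB0]
  · -- UPPER
    have hpt : ∀ x i j, ‖u x i j - 1‖ ^ 2 ≤ 3 * (‖α x i j‖ ^ 2 + ‖β x i j‖ ^ 2 + ‖(u x i j - 1) - α x i j - β x i j‖ ^ 2) :=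
      fun x i j => norm_sub_one_sq_le_three_mul r _ _ _
    have hsum : ∑ x : Site 4 L, ∑ i : Fin 4, ∑ j : Fin 4, ‖u x i j - 1‖ ^ 2 ≤
        3 * (∑ x : Site 4 L, ∑ i : Fin 4, ∑ j : Fin 4, ‖α x i j‖ ^ 2 +
          ∑ x : Site 4 L, ∑ i : Fin 4, ∑ j : Fin 4, ‖β x i j‖ ^ 2 +
          ∑ x : Site 4 L, ∑ i : Fin 4, ∑ j : Fin 4, ‖(u x i j - 1) - α x i j - β x i j‖ ^ 2) := by
      simp only [mul_add, Finset.mul_sum, ← Finset.sum_add_distrib]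
      exact Finset.sum_le_sum fun x _ => Finset.sum_le_sum fun i _ => Finset.sum_le_sum fun j _ => by
        have := hpt x i j; linarith
    have hδsq : δ ^ 2 ≤ 1 / 16 := by
      have h := pow_le_pow_left₀ hδ0 hδ4 2
      calc δ ^ 2 ≤ (1 / 4) ^ 2 := h
        _ = 1 / 16 := by norm_num
    rw [hS]
    have hB0 : 0 ≤ ‖B‖ ^ 2 := sq_nonneg _
    nlinarith [hsum, hα_upper, hβ_upper, hE_sum, hδsq, mul_le_mul_of_nonneg_right hδsq hB0]


/-! ### The cone inequality under scaling -/

/-- **CONE (registered sub-goal of line `Sketch`).** At a flat `τ` there are `δ, K > 0` such that for every slice form `A` with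
`‖A‖ ≤ δ` and every `s ∈ [0, 1]`: `S(cfg τ (s • A)) ≤ K s² S(cfg τ A)` — the action is at least quadratically conical on the gauge
slice (split `A = C + B` along `constForms ≤ slice`; `Q(sC) = s⁴Q(C)`, `‖sB‖² = s²‖B‖²`, two-sided comparison `cone_two_sided`). -/
theorem exists_cone : ∀ {G : Type} [Group G] [TopologicalSpace G] [CompactSpace G] (r : Literature.MathematicalPhysics.QuantumFieldTheory.LatticeRep G) {L : ℕ} [NeZero L] {τ : Literature.MathematicalPhysics.QuantumFieldTheory.GaugeConfig 4 L G}, (∀ (x : Literature.MathematicalPhysics.QuantumFieldTheory.Site 4 L) (i j : Fin 4), Literature.MathematicalPhysics.QuantumFieldTheory.plaquetteHolonomy τ x i j = 1) → ∃ δ K : ℝ, 0 < δ ∧ 0 < K ∧ ∀ A ∈ Summit.QuantumFields.YangMills.Theorems.FemtoCurvatureTwoPointC.Doubling.slice r τ, ‖A‖ ≤ δ → ∀ s : ℝ, 0 ≤ s → s ≤ 1 → Literature.MathematicalPhysics.QuantumFieldTheory.wilsonAction r.ρ (Summit.QuantumFields.YangMills.Theorems.FemtoCurvatureTwoPointC.Doubling.cfg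 r τ (s • A)) ≤ K * s ^ 2 * Literature.MathematicalPhysics.QuantumFieldTheory.wilsonAction r.ρ (Summit.QuantumFields.YangMills.Theorems.FemtoCurvatureTwoPointC.Doubling.cfg r τ A) := by
  intro G _ _ _ r L _ τ hτ
  obtain ⟨δ, k, K, hδ, hk, hK, hcone⟩ := cone_two_sided r hτ
  refine ⟨δ, K / k, hδ, div_pos hK hk, ?_⟩
  intro A hA hAδ s hs0 hs1
  -- split along the constant forms
  set C : OneForm r L := (constForms r τ).starProjection A with hCdef
  set B : OneForm r L := A - C with hBdef
  have hC : C ∈ constForms r τ := Submodule.starProjection_apply_mem _ A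
  have hBorth : B ∈ (constForms r τ)ᗮ := Submodule.sub_starProjection_mem_orthogonal A
  have hBslice : B ∈ slice r τ := (slice r τ).sub_mem hA (constForms_le_slice r τ hC)
  have hB : B ∈ massive r τ := Submodule.mem_inf.2 ⟨hBslice, hBorth⟩
  have hAe : A = C + B := by rw [hBdef]; abel
  have hCn : ‖C‖ ≤ δ := (Submodule.norm_starProjection_apply_le (constForms r τ) A).trans hAδ
  have hBn : ‖B‖ ≤ δ := by
    have horth : ⟪B, C⟫_ℝ = 0 := by
      rw [Submodule.mem_orthogonal'] at hBorth
      exact hBorth C hC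
    have hpy : ‖B + C‖ * ‖B + C‖ = ‖B‖ * ‖B‖ + ‖C‖ * ‖C‖ :=
      norm_add_sq_eq_norm_sq_add_norm_sq_of_inner_eq_zero B C horth
    have hBC : B + C = A := by rw [hBdef]; abel
    rw [hBC] at hpy
    have h1 : ‖B‖ ≤ ‖A‖ := by nlinarith [norm_nonneg B, norm_nonneg A, norm_nonneg C]
    exact h1.trans hAδ
  -- the scaled pieces
  have hsC : s • C ∈ constForms r τ := Submodule.smul_mem _ s hC
  have hsB : s • B ∈ massive r τ := Submodule.smul_mem _ s hB
  have hs_abs : |s| ≤ 1 := by rw [abs_of_nonneg hs0]; exact hs1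
  have hsCn : ‖s • C‖ ≤ δ := by
    rw [norm_smul, Real.norm_eq_abs]; exact (mul_le_of_le_one_left (norm_nonneg C) hs_abs).trans hCn
  have hsBn : ‖s • B‖ ≤ δ := by
    rw [norm_smul, Real.norm_eq_abs]; exact (mul_le_of_le_one_left (norm_nonneg B) hs_abs).trans hBn
  have hsA : s • A = s • C + s • B := by rw [hAe, smul_add]
  obtain ⟨-, hup⟩ := hcone (s • C) hsC (s • B) hsB hsCn hsBn
  obtain ⟨hlow, -⟩ := hcone C hC B hB hCn hBn
  rw [← hAe] at hlow
  rw [hsA]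
  have hcF0 : 0 ≤ commForm r C := commForm_nonneg r C
  have hB0 : 0 ≤ ‖B‖ ^ 2 := sq_nonneg _
  have hs2 : s ^ 4 ≤ s ^ 2 := by nlinarith [pow_le_one₀ hs0 hs1 (n := 2), sq_nonneg s]
  have hscale : commForm r (s • C) + ‖s • B‖ ^ 2 ≤ s ^ 2 * (commForm r C + ‖B‖ ^ 2) := by
    rw [commForm_smul, norm_smul, Real.norm_eq_abs, abs_of_nonneg hs0, mul_pow]
    nlinarith [mul_le_mul_of_nonneg_right hs2 hcF0]
  have hSA0 : k * (commForm r C + ‖B‖ ^ 2) ≤ wilsonAction r.ρ (cfg r τ A) := hlow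
  calc wilsonAction r.ρ (cfg r τ (s • C + s • B)) ≤ K * (commForm r (s • C) + ‖s • B‖ ^ 2) := hup
    _ ≤ K * (s ^ 2 * (commForm r C + ‖B‖ ^ 2)) := mul_le_mul_of_nonneg_left hscale hK.le
    _ = K / k * s ^ 2 * (k * (commForm r C + ‖B‖ ^ 2)) := by field_simp
    _ ≤ K / k * s ^ 2 * wilsonAction r.ρ (cfg r τ A) :=
        mul_le_mul_of_nonneg_left hSA0 (by positivity)

end Summit.QuantumFields.YangMills.Theorems.FemtoCurvatureTwoPointC.Doubling

end
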